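import Mathlib
import Literature.NumberTheory.LFunctions.Zhang2022.Section6Statements
import Literature.NumberTheory.LFunctions.Zhang2022.Section2FunctionalEquation
import HarnessLib

/-!
# Zhang (2022), §6: the functional-equation step of the proof of Lemma 6.1 — DISCHARGED

Topic `Literature/NumberTheory/LFunctions/Zhang2022` (Landau–Siegel audit tree; verdict-neutral).
Y. Zhang, *Discrete mean estimates and the Landau–Siegel zero*, arXiv:2211.02515v1 (2022)
[Zhang2022LandauSiegel] — **an unrefereed manuscript under adjudication**; campaign D-0069
(typed ≠ discharged). This file DISCHARGES one proof-internal CLAIM node of §6 (PDF p. 31,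
tex L1724), typed statement-exact by `Section6Statements` (L2-t1, v2 p412099) as `Section6Statements.Step6u009`
(DAG `Z22:§6.u009`; v1 name `Section6.StepFE`):

> For `u = −1` we have, by the functional equation (2.2) with `θ = ψ`,
> `L(s+w,ψ) = Z(s+w,ψ)(Σ_{n<T³} ψ̄(n)n^{−(1−s−w)} + Σ_{n≥T³} ψ̄(n)n^{−(1−s−w)})`.

Proof (0 new facts): the tree's (2.2) `GammaFactor.LFunction_eq_Zfac_mul` is restated without its
`Im s ≠ 0` side condition (`LFunction_eq_Zfac_mul_of_gammaFactor_ne_zero`: only the archimedean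
factor `γ(ψ̄, 1−s)` must be finite and non-zero, which holds for `Re(1−s) > 0`); on `u = −1` and
`|σ − 1/2| < 2α < 1/2` (i.e. `D ≥ 4`) one has `Re(1−s−w) = 2 − σ > 1`, so `L(1−s−w,ψ̄)` is its
absolutely convergent Dirichlet series (Mathlib `DirichletCharacter.LFunction_eq_LSeries`), which
splits as the finite head `n < T³` (`Section6Statements.headSum`) plus the tail `tsum`
(`Section6Statements.tailSum`). The blanket Assumption (A) carried by the typed node is not used.
FACT-LIST handles used: F-06 (functional equation; Mathlib `completedLFunction_one_sub` via the
tree's `Section2FunctionalEquation`). WHAT THIS IS NOT: any claim about Theorems 1–2 of the source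
or about Landau–Siegel zeros.

## References

* Y. Zhang, arXiv:2211.02515v1 (2022), §6 p. 31 (proof of Lemma 6.1), §2 (2.2).
  [cite: Zhang2022LandauSiegel, §6 p.31, tex L1724; §2 (2.2)]
-/

noncomputable section

open Complex Real ComplexConjugate

namespace Literature.NumberTheory.LFunctions.Zhang2022.Section6Statements

open Skeleton

/-! ## The functional equation (2.2) without the `Im s ≠ 0` side condition -/

/-- Mathlib's archimedean factor `γ(θ,z)` (`Γ_ℝ(z)` or `Γ_ℝ(z+1)`) is non-zero for `Re z > 0`
(its zeros, as a junk-valued total function, sit at the poles `z ∈ −2ℕ` resp. `−1−2ℕ`); the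
finiteness/non-vanishing of the archimedean factors in (2.2). [cite: Zhang2022LandauSiegel, §2 (2.2)] -/
theorem gammaFactor_ne_zero_of_re_pos {k : ℕ} (θ : DirichletCharacter ℂ k) {z : ℂ}
    (hz : 0 < z.re) : DirichletCharacter.gammaFactor θ z ≠ 0 := by
  have hΓ : ∀ u : ℂ, 0 < u.re → Gammaℝ u ≠ 0 := by
    intro u hu
    rw [Ne, Gammaℝ_eq_zero_iff]
    rintro ⟨n, hn⟩
    rw [hn] at hu
    simp at hu
    linarith [Nat.cast_nonneg (α := ℝ) n]
  unfold DirichletCharacter.gammaFactor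
  split_ifs
  · exact hΓ z hz
  · exact hΓ (z + 1) (by simp; linarith)

/-- **(2.2) `L(s,θ) = Z(s,θ)L(1−s,θ̄)`** for a primitive `θ` mod `k ≠ 1`, at every `s` where the
archimedean factor `γ(θ̄,1−s)` is finite and non-zero — the tree's
`GammaFactor.LFunction_eq_Zfac_mul` with its side condition `Im s ≠ 0` replaced by exactly what
its proof uses. [cite: Zhang2022LandauSiegel, §2 (2.2)] -/
theorem LFunction_eq_Zfac_mul_of_gammaFactor_ne_zero {k : ℕ} [NeZero k]
    {θ : DirichletCharacter ℂ k} (hθ : θ.IsPrimitive) (hk : k ≠ 1) {s : ℂ}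
    (hγ : DirichletCharacter.gammaFactor θ⁻¹ (1 - s) ≠ 0) :
    θ.LFunction s = GammaFactor.Zfac θ s * θ⁻¹.LFunction (1 - s) := by
  classical
  have hk0 : (k : ℂ) ≠ 0 := Nat.cast_ne_zero.mpr (NeZero.ne k)
  have h1 := DirichletCharacter.LFunction_eq_completed_div_gammaFactor θ s (Or.inr hk)
  have h2 := DirichletCharacter.IsPrimitive.completedLFunction_one_sub hθ (1 - s)
  rw [sub_sub_cancel] at h2
  have h3 := DirichletCharacter.LFunction_eq_completed_div_gammaFactor θ⁻¹ (1 - s) (Or.inr hk)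
  have h3' : DirichletCharacter.completedLFunction θ⁻¹ (1 - s)
      = θ⁻¹.LFunction (1 - s) * DirichletCharacter.gammaFactor θ⁻¹ (1 - s) := by
    rw [h3, div_mul_cancel₀ _ hγ]
  have hρ : (k : ℂ) ^ ((1 : ℂ) - s - 1 / 2) * DirichletCharacter.rootNumber θ
      = (if θ.Even then 1 else -I) * GammaFactor.tau θ * (k : ℂ) ^ (-s) := by
    unfold DirichletCharacter.rootNumber
    have hkpow : (k : ℂ) ^ ((1 : ℂ) - s - 1 / 2) = (k : ℂ) ^ (-s) * (k : ℂ) ^ ((1 : ℂ) / 2) := by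
      rw [← cpow_add _ _ hk0]; congr 1; ring
    have hkh : (k : ℂ) ^ ((1 : ℂ) / 2) ≠ 0 := by
      rw [Ne, cpow_eq_zero_iff, not_and_or]; exact Or.inl hk0
    rw [hkpow, GammaFactor.tau]
    split_ifs with he
    · rw [pow_zero, div_one]
      field_simp
    · rw [pow_one]
      field_simp
      rw [I_sq]
      ring
  calc θ.LFunction s
      = DirichletCharacter.completedLFunction θ s / DirichletCharacter.gammaFactor θ s := h1
    _ = ((k : ℂ) ^ ((1 : ℂ) - s - 1 / 2) * DirichletCharacter.rootNumber θ)
          * (DirichletCharacter.gammaFactor θ⁻¹ (1 - s) / DirichletCharacter.gammaFactor θ s)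
          * θ⁻¹.LFunction (1 - s) := by
        rw [h2, h3']
        ring
    _ = GammaFactor.Zfac θ s * θ⁻¹.LFunction (1 - s) := by
        rw [hρ, GammaFactor.Zfac_eq_gammaFactor_div]

/-! ## The Dirichlet series of `L(z,ψ̄)` split at `T³` -/

/-- `conj ψ(n) = ψ̄(n)` with `ψ̄ = ψ⁻¹`. [folklore] -/
private theorem conj_apply_eq_inv_apply {k : ℕ} (ψ : DirichletCharacter ℂ k) (n : ZMod k) :
    conj (ψ n) = ψ⁻¹ n := by
  rw [← MulChar.star_apply']
  rfl

variable {D : ℕ}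

/-- `ψ̄(0) = 0` (the modulus `p` of a member of `Ψ` is a prime, so `0` is not a unit mod `p`). [folklore] -/
private theorem psiBarFn_zero (x : Chr D) : psiBarFn x 0 = 0 := by
  haveI : Fact (1 < x.p) := ⟨x.prime.one_lt⟩
  simp only [psiBarFn, Nat.cast_zero, MulChar.map_zero, map_zero]

/-- For `Re z > 1`, `L(z,ψ̄) = Σ_{n<X} ψ̄(n)n^{−z} + Σ_{n≥X} ψ̄(n)n^{−z}` (`X = T³ > 0`), the tail as
the `tsum` of `Section6Statements.tailSum` — the split "`Σ_{n<T³} + Σ_{n≥T³}`" of §6 p. 31.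
[cite: Zhang2022LandauSiegel, §6 p.31, tex L1724] -/
theorem LFunction_inv_eq_head_add_tail (x : Chr D) {z : ℂ} (hz : 1 < z.re) {X : ℝ} (hX : 0 < X) :
    x.ψ⁻¹.LFunction z =
      (∑ n ∈ Finset.Ico 1 ⌈X⌉₊, psiBarFn x n * (n : ℂ) ^ (-z)) +
        ∑' n : ℕ, if X ≤ (n : ℝ) then psiBarFn x n * (n : ℂ) ^ (-z) else 0 := by
  set F : ℕ → ℂ := fun n => psiBarFn x n * (n : ℂ) ^ (-z) with hF
  have hf0 : (fun n : ℕ => x.ψ⁻¹ (n : ZMod x.p)) 0 = 0 := by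
    haveI : Fact (1 < x.p) := ⟨x.prime.one_lt⟩
    simp only [Nat.cast_zero, MulChar.map_zero]
  have hterm : ∀ n : ℕ, LSeries.term (fun n : ℕ => x.ψ⁻¹ (n : ZMod x.p)) z n = F n := by
    intro n
    rw [LSeries.term_def₀ hf0, hF]
    simp only [psiBarFn, conj_apply_eq_inv_apply]
  have hsum : Summable F := by
    have h := DirichletCharacter.LSeriesSummable_of_one_lt_re x.ψ⁻¹ hz
    rw [LSeriesSummable] at h
    exact h.congr hterm
  rw [DirichletCharacter.LFunction_eq_LSeries _ hz, LSeries, tsum_congr hterm,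
    ← hsum.sum_add_tsum_compl (s := Finset.Ico 1 ⌈X⌉₊), tsum_subtype]
  congr 1
  refine tsum_congr fun n => ?_
  by_cases hn : n = 0
  · subst hn
    have h0 : F 0 = 0 := by rw [hF]; simp [psiBarFn_zero]
    simp [Set.indicator, h0, not_le.mpr hX]
  · have hn1 : 1 ≤ n := Nat.one_le_iff_ne_zero.mpr hn
    by_cases hXn : X ≤ (n : ℝ)
    · have hmem : n ∈ ((↑(Finset.Ico 1 ⌈X⌉₊) : Set ℕ)ᶜ) := by
        simp only [Set.mem_compl_iff, Finset.coe_Ico, Set.mem_Ico, not_and, not_lt]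
        exact fun _ => Nat.ceil_le.mpr hXn
      rw [Set.indicator_of_mem hmem, if_pos hXn]
    · have hmem : n ∉ ((↑(Finset.Ico 1 ⌈X⌉₊) : Set ℕ)ᶜ) := by
        simp only [Set.mem_compl_iff, Finset.coe_Ico, Set.mem_Ico, not_not]
        exact ⟨hn1, Nat.lt_ceil.mpr (lt_of_not_ge hXn)⟩
      rw [Set.indicator_of_notMem hmem, if_neg hXn]

/-! ## The discharge -/

/-- `α = π𝓛⁻⁹ < 1/4` once `D ≥ 4` (`𝓛 = log D ≥ log 4 > 4/3`, `𝓛⁹ > 4π`; `α = π/log P`, (2.10)).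
[cite: Zhang2022LandauSiegel, §2 (2.10)] -/
theorem alpha_lt_quarter {D : ℕ} (hD : 4 ≤ D) : alpha D < 1 / 4 := by
  have hD' : (4 : ℝ) ≤ D := by exact_mod_cast hD
  have hlog : (4 : ℝ) / 3 < Real.log D := by
    have h4 : (4 : ℝ) / 3 < Real.log 4 := by
      rw [Real.lt_log_iff_exp_lt (by norm_num)]
      have := Real.exp_one_lt_d9
      have h : Real.exp (4 / 3) = Real.exp 1 * Real.exp (1 / 3) := by
        rw [← Real.exp_add]; norm_num
      have h3 : Real.exp (1 / 3) < 1.4 := by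
        have key : Real.exp (1 / 3) ^ 3 = Real.exp 1 := by
          rw [← Real.exp_nat_mul]; norm_num
        by_contra hc
        push Not at hc
        have : (1.4 : ℝ) ^ 3 ≤ Real.exp (1 / 3) ^ 3 := by gcongr
        rw [key] at this
        linarith
      rw [h]
      nlinarith [Real.exp_pos (1 / 3), Real.exp_pos 1]
    exact h4.trans_le (Real.log_le_log (by norm_num) hD')
  have hℓ : alpha D = π / Real.log D ^ 9 := by rw [alpha, bigP, Real.log_exp, ell]
  rw [hℓ, div_lt_iff₀ (by positivity)]
  have h9 : ((4 : ℝ) / 3) ^ 9 < Real.log D ^ 9 := by gcongr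
  have hπ : π < 3.15 := Real.pi_lt_d2
  norm_num at h9
  linarith

/-- `Z22:§6.u009` DISCHARGED — the node `Section6Statements.Step6u009` HOLDS (with `D₀ = 4`; the
(A) antecedent is not needed): for `ψ ∈ Ψ`,
`|σ − 1/2| < 2α`, `|t − 2πt₀| < 𝓛₁ + 2` and every real `v`, on `w = −1 + iv`,
`L(s+w,ψ) = Z(s+w,ψ)(Σ_{n<T³} ψ̄(n)n^{−(1−s−w)} + Σ_{n≥T³} ψ̄(n)n^{−(1−s−w)})` — the functional
equation (2.2) (tree `Section2FunctionalEquation`, from Mathlib's `completedLFunction_one_sub`)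
followed by the Dirichlet-series expansion of `L(1−s−w,ψ̄)` on `Re(1−s−w) = 2 − σ > 1`.
[cite: Zhang2022LandauSiegel, §6 p.31, tex L1724] -/
theorem step6u009_holds : Step6u009 := by
  refine ⟨4, fun D _ χ hD _ _ _ x s hr v => ?_⟩
  have hα := alpha_lt_quarter hD
  have hσ : |s.re - 1 / 2| < 2 * alpha D := hr.1
  have hσ' : s.re < 1 := by
    have := (abs_lt.mp hσ).2
    linarith
  have hT : 0 < bigT D ^ 3 := pow_pos (Real.exp_pos _) 3
  have hz : 1 < (1 - (s + (-1 + v * I))).re := by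
    simp
    linarith
  have hγ : DirichletCharacter.gammaFactor x.ψ⁻¹ (1 - (s + (-1 + v * I))) ≠ 0 :=
    gammaFactor_ne_zero_of_re_pos _ (by linarith)
  rw [LFunction_eq_Zfac_mul_of_gammaFactor_ne_zero x.prim x.p_ne_one hγ,
    LFunction_inv_eq_head_add_tail x hz hT, headSum, tailSum]
  have e : (1 : ℂ) - (s + (-1 + v * I)) = 1 - s - (-1 + v * I) := by ring
  rw [e]

end Literature.NumberTheory.LFunctions.Zhang2022.Section6Statements
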